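import Literature.MathematicalPhysics.QuantumFieldTheory.Balaban1983to89.B4LeafRegular
import Literature.MathematicalPhysics.QuantumFieldTheory.Balaban1983to89.B4ThmBoxPairEtaNoCollar

/-!
# `Balaban1983to89.B4ThmJoinFam` — [Balaban1983RegularityDecay] THEOREM p. 573 (1.9)–(1.12) WITH ONE SET OF CONSTANTS ON
# THE JOIN OF THE TREE'S THREE (1.7)-REGULAR FAMILIES: lattice big-block pairs (`R₀` live), lattice parallelepiped pairs
# (NO restriction — the printed waiver), torus pairs; the typed `ThmPrintedNN` is monotone in its constants and closed
# under finite joins of families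

statement-level skeleton of published theorems with citation tags; proofs where landed; nothing here is a claim about the Yang–Mills mass gap

CITATION HEADER.  T. Bałaban, *Regularity and decay of lattice Green's functions*, Commun. Math. Phys. **89** (1983)
571–597, doi:10.1007/bf01214744 [Balaban1983RegularityDecay] (cell paper B4; held text
`paper:balaban1983-cmp89-regularity-decay`, journal page = PDF page + 570; p. 572 (1.7) and the two settings, p. 573
Theorem (1.9)–(1.12) with its last sentence).  Cell `pub-ymgap`, Track-A seat `pub-ymgap-dag-p3` gen 2 (node N01 of
YM-PLAN §2; payload OPS-REQUESTS l.312 § dag-p3; house rules R415; INTENT-2 INBOX l.8760).  THEOREMS ONLY: no `def`,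
no `Prop`-valued fact, no `sorry`; axioms standard.  USED BY NAME, never restated: b04's `B4.EtaSetting` ∕ `Ineq19_110`
∕ `Ineq111_112`, pv17's `B4Ineq111ZeroNestEta.ThmPrintedNN`, r01's `B4ThmRegionPairEta.{regionPairFam, Kmod,
thmPrintedNN_regionPairFam, hypotheses_met}` (g8) and `B4ThmTorusPairEta.{thmPrintedNN_torusPairFam, hypotheses_met}`
on `B4TorusPairFam.torusPairFam` (g9), r04's `B4ThmBoxPairEtaNoCollar.{boxPairFamNC, KmodNC, thmPrintedNN_boxPairFamNC,
hypotheses_met_noCollar}` (g15, on p17's `B4ThmBoxPairEta.BoxPairInst`), the sign lemmas of the three carriers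
(`RegionPairInst.{sdist1_nonneg, cdist_nonneg, bdistS_nonneg}`, `B4TorusPairFam.{tsdist1_nonneg, tcdist_nonneg,
tbdistS_nonneg}`, `BoxPairInst.{sdist1_nonneg, bdist1_nonneg, bdistS_nonneg}`, `B4Lemma22Reduce231.supN_nonneg`), and
for the leaf p17's `B4Prop23RegularWindow.prop23Printed_regularWindow`, p35's `B4Prop31Regular.prop31Printed_regularRegion`,
pv23's `B4Sect5Proof.sect5ThmUniform_holds` (as in r01's `B4LeafRegular`).

WHAT IS PRINTED (verbatim).  p. 572: «We consider a lattice ηZ^d or its subsets, with η = L^{−k} … Another common case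
is to consider operators on subsets of a torus T_η which we identify with a rectangular parallelepiped in ηZ^d with
periodic conditions. … We consider subsets Ω which are unions of big blocks.»; (1.7) «|(∂^η_μ A)(x)| ≤ c e^{β−1}, x ∈ Ω,
β > 0»; p. 573: «Theorem (Proposition 2.1 of [1]). For α < 1 there exist positive constants δ₀, c₀, R₀ independent of
A, k, Ω and depending on d, M only, c₀ on α also, such that for e sufficiently small and for an arbitrary function
f : Ω → R^N, we have (1.9) … for x, x′ ∈ Ω, and satisfying the condition dist({x,x′}, Ω^c) ≥ R₀. Similarly (1.10) …
for x ∈ Ω, dist(x, Ω^c) ≥ R₀. If Ω ⊂ Ω₀, then for δG_k(Ω,Ω₀,A) … (1.11) we have the inequalities … with the additional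
factor (1.12) … For some simple sets Ω, e.g. for rectangular parallelepipeds, the inequalities hold without any
restrictions on the points x, x′, i.e. for all x, x′ ∈ Ω.»

WHY THIS FILE.  The tree proves the typed Theorem (`ThmPrintedNN`, ruled reading `0 ≤ α < 1`, G-ref1-32) separately on
three families of b04's `EtaSetting`, each with ITS OWN constants: (L) `regionPairFam` — general pairs `Ω ⊂ Ω₀` of finite
unions of big blocks in `ηℤ^{d+1}`, `rect := False` (the `R₀` restriction on every instance); (B) `boxPairFamNC` — nested
pairs of rectangular parallelepipeds `Ω ⊂ Ω₀ ⊂ ηℤ^{d+1}`, `rect := True` (NO restriction on `x, x′`: the printed waiver,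
kernel-proved by the Neumann-gauge route of r04's collar-drop programme); (T) `torusPairFam` — pairs `Ω ⊂ Ω₀ ⊂ T_η` of
unions of big blocks of a discrete torus, `rect := «Ω = T_η»` (the waiver on the full torus only; proper sub-boxes of the
torus keep `R₀`, because (T) is transferred from (L) by periodic lifting).  The NODE 00 family of record for the DAG leaf
`b4` is (T) alone (`Node00.CarriersFrame.carriers₁_groupB4`), whence the located species word «`rect` typed weaker than
print» of YM-PLAN row N01 (R325 D2, XREAD-B4 v0.5 §4).  This module shows, by bookkeeping only, that ONE set of
constants serves the DISJOINT UNION of the three families — i.e. the print's Theorem on BOTH of its settings at once, with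
the parallelepiped waiver wherever the tree has it — and packages the four-conjunct leaf with that joined `η`-family.
A later Stage-1 re-pin `famE :=` the join (node00-def ∕ the leads' decision, not made here) would narrow N01's `rect`
residual to: (α) proper sub-parallelepipeds of the torus, (β) lattice `Ω` a parallelepiped inside a GENERAL `Ω₀` — neither
is claimed here.

WHAT THIS MODULE PROVES (all in full).
* §1 `ineq19_110_mono`, `ineq111_112_mono` — (1.9)–(1.12) for one setting are MONOTONE in `(δ₀ ↓, c₀ ↑, R₀ ↑)` when the
  setting's distances and sup-norm are non-negative (the only structure the abstract carrier lacks).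
* §2 **`thmPrintedNN_sumElim`** — `ThmPrintedNN fam₁ → ThmPrintedNN fam₂ → ThmPrintedNN (Sum.elim fam₁ fam₂)` for families
  with non-negative distance ∕ norm functionals (constants `min δ₀`, `max c₀`, `max R₀`, `min e₁`); the converse
  restrictions `thmPrintedNN_of_sumElim_left ∕ _right` (no sign hypothesis).
* §3 `regionPairFam_signs`, `boxPairFamNC_signs`, `torusPairFam_signs` — the six sign facts for each concrete family,
  from the lineages' own lemmas.
* §4 **`thmPrintedNN_latticeJoin`** — (L) ⊕ (B): the print's LATTICE sentence incl. the parallelepiped waiver for box pairs;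
  **`thmPrintedNN_join3`** — ((L) ⊕ (B)) ⊕ (T): both printed settings, one `(δ₀, c₀, R₀, e₁)` per `α ∈ [0,1)`.
* §5 **`leafNN_join3`** — the four conjuncts of the DAG leaf `b4` (NN form) with `famE :=` the triple join and the
  `famU ∕ famF ∕ (d, N)` legs of `B4LeafRegular.leafNN_torusPairFam` unchanged; `join3_nonvacuous` — every summand has
  members meeting `regular ∧ bigBlocks ∧ 0 < e ≤ e₁` for every threshold `e₁ > 0`.
HONEST SCOPE.  Bookkeeping over existing kernel theorems; no analytic estimate is proved here.  The join's three summands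
keep their own side conditions (`bigBlocks` with `Kmod` on (L), (T) and `KmodNC` on (B); `regular` = (1.7) on `Ω₀`;
`d ≥ 1` is needed by (B)).  The waiver is NOT extended to torus sub-boxes (α) nor to lattice boxes inside general regions
(β); `lhs19` (sup over admissible contours) and the other readings are the lineages', unchanged.  Count-neutral for YM-PLAN
(typed 28∕28 · discharged 0∕28 unmoved); nothing here concerns the continuum, ℝ⁴, OS axioms, a mass gap or the Clay problem.
-/

namespace Literature.MathematicalPhysics.QuantumFieldTheory.Balaban1983to89.B4ThmJoinFam

open Literature.MathematicalPhysics.QuantumFieldTheory.Balaban1983to89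
open Literature.MathematicalPhysics.QuantumFieldTheory.Balaban1983to89.B4 (EtaSetting Ineq19_110 Ineq111_112
  Prop23Printed Prop31Printed Sect5ThmUniform)
open Literature.MathematicalPhysics.QuantumFieldTheory.Balaban1983to89.B4Ineq111ZeroNestEta (ThmPrintedNN)
open Literature.MathematicalPhysics.QuantumFieldTheory.Balaban1983to89.B4GaugeCovariance (OrthFlow)
open Literature.MathematicalPhysics.QuantumFieldTheory.Balaban1983to89.B4Lemma22Reduce231 (supN_nonneg)
open Literature.MathematicalPhysics.QuantumFieldTheory.Balaban1983to89.B4ThmRegionPairEta (RegionPairInst regionPairFam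
  Kmod thmPrintedNN_regionPairFam)
open Literature.MathematicalPhysics.QuantumFieldTheory.Balaban1983to89.B4TorusPairFam (TorusPairInst torusPairFam
  tsdist1_nonneg tcdist_nonneg tbdistS_nonneg)
open Literature.MathematicalPhysics.QuantumFieldTheory.Balaban1983to89.B4ThmTorusPairEta (thmPrintedNN_torusPairFam)
open Literature.MathematicalPhysics.QuantumFieldTheory.Balaban1983to89.B4ThmBoxPairEta (BoxPairInst boxPairFam)
open Literature.MathematicalPhysics.QuantumFieldTheory.Balaban1983to89.B4ThmBoxPairEtaNoCollar (boxPairFamNC KmodNC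
  thmPrintedNN_boxPairFamNC hypotheses_met_noCollar)
open Literature.MathematicalPhysics.QuantumFieldTheory.Balaban1983to89.B4Prop23RegularWindow (regularFieldRegionsW
  prop23Printed_regularWindow)
open Literature.MathematicalPhysics.QuantumFieldTheory.Balaban1983to89.B4Prop31Regular (regularFormSetting
  prop31Printed_regularRegion)
open Literature.MathematicalPhysics.QuantumFieldTheory.Balaban1983to89.B4Sect5Proof (sect5ThmUniform_holds)
open scoped Matrix

/-! ## §1. (1.9)–(1.12) for one setting are monotone in the constants -/

/-- an exponential factor `e^{−δs}` is antitone in `δ` for `s ≥ 0`. [folklore] -/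
private theorem exp_neg_mul_mono {δ δ' s : ℝ} (hδ : δ' ≤ δ) (hs : 0 ≤ s) :
    Real.exp (-(δ * s)) ≤ Real.exp (-(δ' * s)) :=
  Real.exp_le_exp.2 (neg_le_neg (mul_le_mul_of_nonneg_right hδ hs))

/-- the right-hand side `c·e^{−δs}·N` of (1.9)–(1.10) is monotone in `(δ ↓, c ↑)` for `s, N ≥ 0`, `c ≥ 0`. [folklore] -/
private theorem rhs_mono {c c' δ δ' s N : ℝ} (hc : c ≤ c') (hc0 : 0 ≤ c) (hδ : δ' ≤ δ) (hs : 0 ≤ s) (hN : 0 ≤ N) :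
    c * Real.exp (-(δ * s)) * N ≤ c' * Real.exp (-(δ' * s)) * N :=
  mul_le_mul_of_nonneg_right (mul_le_mul hc (exp_neg_mul_mono hδ hs) (Real.exp_pos _).le (hc0.trans hc)) hN

/-- the right-hand side `c·e^{−δs}·e^{−(δb + δb′)}·N` of (1.11)–(1.12) is monotone in `(δ ↓, c ↑)` for `s, b, b′, N ≥ 0`,
`c ≥ 0`. [folklore] -/
private theorem rhs_mono' {c c' δ δ' s b b' N : ℝ} (hc : c ≤ c') (hc0 : 0 ≤ c) (hδ : δ' ≤ δ) (hs : 0 ≤ s)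
    (hb : 0 ≤ b) (hb' : 0 ≤ b') (hN : 0 ≤ N) :
    c * Real.exp (-(δ * s)) * Real.exp (-(δ * b + δ * b')) * N ≤
      c' * Real.exp (-(δ' * s)) * Real.exp (-(δ' * b + δ' * b')) * N := by
  have h2 : Real.exp (-(δ * b + δ * b')) ≤ Real.exp (-(δ' * b + δ' * b')) := by
    rw [← mul_add, ← mul_add]
    exact exp_neg_mul_mono hδ (add_nonneg hb hb')
  refine mul_le_mul_of_nonneg_right ?_ hN
  exact mul_le_mul (mul_le_mul hc (exp_neg_mul_mono hδ hs) (Real.exp_pos _).le (hc0.trans hc)) h2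
    (Real.exp_pos _).le (mul_nonneg (hc0.trans hc) (Real.exp_pos _).le)

/-- **(1.9)–(1.10) ARE MONOTONE IN THE CONSTANTS**: if `Ineq19_110 S α δ₀ c₀ R₀` holds and `δ₀′ ≤ δ₀`, `0 ≤ c₀ ≤ c₀′`,
`R₀ ≤ R₀′`, then `Ineq19_110 S α δ₀′ c₀′ R₀′` — provided the setting's `dist(·, supp f)`, `dist({x,x′}, supp f)` and
`‖f‖_∞` are non-negative (a larger `R₀` only removes instances of the hypothesis `dist ≥ R₀`; the waiver disjunct `rect` is
untouched). [cite: Balaban1983RegularityDecay, Theorem (1.9)–(1.10) p.573 (bookkeeping on the typed form)] -/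
theorem ineq19_110_mono (S : EtaSetting) {α δ c R δ' c' R' : ℝ} (hδ : δ' ≤ δ) (hc : c ≤ c') (hc0 : 0 ≤ c)
    (hR : R ≤ R') (hs1 : ∀ x f, 0 ≤ S.sdist1 x f) (hs2 : ∀ x x' f, 0 ≤ S.sdist2 x x' f)
    (hN : ∀ f, 0 ≤ S.supNorm f) (h : Ineq19_110 S α δ c R) : Ineq19_110 S α δ' c' R' := by
  refine ⟨fun μ f x x' hx => ?_, fun μ f x hx => ?_⟩
  · have hx' : S.rect ∨ R ≤ S.bdist2 x x' := hx.imp_right fun h' => hR.trans h'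
    exact (h.1 μ f x x' hx').trans (rhs_mono hc hc0 hδ (hs2 x x' f) (hN f))
  · have hx' : S.rect ∨ R ≤ S.bdist1 x := hx.imp_right fun h' => hR.trans h'
    obtain ⟨h1, h2⟩ := h.2 μ f x hx'
    exact ⟨h1.trans (rhs_mono hc hc0 hδ (hs1 x f) (hN f)), h2.trans (rhs_mono hc hc0 hδ (hs1 x f) (hN f))⟩

/-- **(1.11)–(1.12) ARE MONOTONE IN THE CONSTANTS** (same shape; the additional factor (1.12) needs `dist(x, Ω^c)`,
`dist({x,x′}, Ω^c)`, `dist(supp f, Ω^c) ≥ 0`). [cite: Balaban1983RegularityDecay, Theorem (1.11)–(1.12) p.573 (bookkeeping on the typed form)] -/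
theorem ineq111_112_mono (S : EtaSetting) {α δ c R δ' c' R' : ℝ} (hδ : δ' ≤ δ) (hc : c ≤ c') (hc0 : 0 ≤ c)
    (hR : R ≤ R') (hs1 : ∀ x f, 0 ≤ S.sdist1 x f) (hs2 : ∀ x x' f, 0 ≤ S.sdist2 x x' f)
    (hb1 : ∀ x, 0 ≤ S.bdist1 x) (hb2 : ∀ x x', 0 ≤ S.bdist2 x x') (hbS : ∀ f, 0 ≤ S.bdistS f)
    (hN : ∀ f, 0 ≤ S.supNorm f) (h : Ineq111_112 S α δ c R) : Ineq111_112 S α δ' c' R' := by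
  refine ⟨fun μ f x x' hx => ?_, fun μ f x hx => ?_⟩
  · have hx' : S.rect ∨ R ≤ S.bdist2 x x' := hx.imp_right fun h' => hR.trans h'
    exact (h.1 μ f x x' hx').trans (rhs_mono' hc hc0 hδ (hs2 x x' f) (hb2 x x') (hbS f) (hN f))
  · have hx' : S.rect ∨ R ≤ S.bdist1 x := hx.imp_right fun h' => hR.trans h'
    obtain ⟨h1, h2⟩ := h.2 μ f x hx'
    exact ⟨h1.trans (rhs_mono' hc hc0 hδ (hs1 x f) (hb1 x) (hbS f) (hN f)),
      h2.trans (rhs_mono' hc hc0 hδ (hs1 x f) (hb1 x) (hbS f) (hN f))⟩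

/-! ## §2. `ThmPrintedNN` is closed under binary joins of families (and restricts to the summands) -/

/-- **THE TYPED THEOREM IS CLOSED UNDER JOINS OF FAMILIES.**  If `ThmPrintedNN` holds on two families of settings whose
distance and sup-norm functionals are non-negative, it holds on their disjoint union `Sum.elim fam₁ fam₂` — for each
`α ∈ [0,1)` take `δ₀ = min`, `c₀ = max`, `R₀ = max`, `e₁ = min` of the two quadruples and use §1.  (The sign hypotheses
are one conjunction per family: `dist(x, supp f)`, `dist({x,x′}, supp f)`, `dist(x, Ω^c)`, `dist({x,x′}, Ω^c)`,
`dist(supp f, Ω^c)`, `‖f‖_∞ ≥ 0` at every instance.) [cite: Balaban1983RegularityDecay, Theorem (1.9)–(1.12) p.573 «constants δ₀, c₀, R₀ independent of A, k, Ω» (bookkeeping: one set of constants for a union of instance families)] -/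
theorem thmPrintedNN_sumElim {I₁ I₂ : Type} (fam₁ : I₁ → EtaSetting) (fam₂ : I₂ → EtaSetting)
    (hsg₁ : ∀ i, (∀ x f, 0 ≤ (fam₁ i).sdist1 x f) ∧ (∀ x x' f, 0 ≤ (fam₁ i).sdist2 x x' f) ∧
      (∀ x, 0 ≤ (fam₁ i).bdist1 x) ∧ (∀ x x', 0 ≤ (fam₁ i).bdist2 x x') ∧ (∀ f, 0 ≤ (fam₁ i).bdistS f) ∧
      (∀ f, 0 ≤ (fam₁ i).supNorm f))
    (hsg₂ : ∀ i, (∀ x f, 0 ≤ (fam₂ i).sdist1 x f) ∧ (∀ x x' f, 0 ≤ (fam₂ i).sdist2 x x' f) ∧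
      (∀ x, 0 ≤ (fam₂ i).bdist1 x) ∧ (∀ x x', 0 ≤ (fam₂ i).bdist2 x x') ∧ (∀ f, 0 ≤ (fam₂ i).bdistS f) ∧
      (∀ f, 0 ≤ (fam₂ i).supNorm f))
    (h₁ : ThmPrintedNN fam₁) (h₂ : ThmPrintedNN fam₂) : ThmPrintedNN (Sum.elim fam₁ fam₂) := by
  intro α hα0 hα1
  obtain ⟨δ₁, c₁, R₁, e₁, hδ₁, hc₁, hR₁, he₁, H₁⟩ := h₁ α hα0 hα1
  obtain ⟨δ₂, c₂, R₂, e₂, hδ₂, hc₂, hR₂, he₂, H₂⟩ := h₂ α hα0 hα1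
  refine ⟨min δ₁ δ₂, max c₁ c₂, max R₁ R₂, min e₁ e₂, lt_min hδ₁ hδ₂, lt_max_of_lt_left hc₁,
    lt_max_of_lt_left hR₁, lt_min he₁ he₂, ?_⟩
  rintro (i | i) hreg hbig he hle
  · obtain ⟨hs1, hs2, hb1, hb2, hbS, hN⟩ := hsg₁ i
    obtain ⟨hA, hB⟩ := H₁ i hreg hbig he (hle.trans (min_le_left _ _))
    exact ⟨ineq19_110_mono (fam₁ i) (min_le_left _ _) (le_max_left _ _) hc₁.le (le_max_left _ _) hs1 hs2 hN hA,
      ineq111_112_mono (fam₁ i) (min_le_left _ _) (le_max_left _ _) hc₁.le (le_max_left _ _) hs1 hs2 hb1 hb2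
        hbS hN hB⟩
  · obtain ⟨hs1, hs2, hb1, hb2, hbS, hN⟩ := hsg₂ i
    obtain ⟨hA, hB⟩ := H₂ i hreg hbig he (hle.trans (min_le_right _ _))
    exact ⟨ineq19_110_mono (fam₂ i) (min_le_right _ _) (le_max_right _ _) hc₂.le (le_max_right _ _) hs1 hs2 hN
        hA,
      ineq111_112_mono (fam₂ i) (min_le_right _ _) (le_max_right _ _) hc₂.le (le_max_right _ _) hs1 hs2 hb1
        hb2 hbS hN hB⟩

/-- restriction of the typed Theorem from a join to its left summand (no sign hypothesis). [cite: Balaban1983RegularityDecay, Theorem p.573 (bookkeeping)] -/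
theorem thmPrintedNN_of_sumElim_left {I₁ I₂ : Type} (fam₁ : I₁ → EtaSetting) (fam₂ : I₂ → EtaSetting)
    (h : ThmPrintedNN (Sum.elim fam₁ fam₂)) : ThmPrintedNN fam₁ := by
  intro α hα0 hα1
  obtain ⟨δ₀, c₀, R₀, e₁, hδ, hc, hR, he, H⟩ := h α hα0 hα1
  exact ⟨δ₀, c₀, R₀, e₁, hδ, hc, hR, he, fun i => H (Sum.inl i)⟩

/-- restriction of the typed Theorem from a join to its right summand (no sign hypothesis). [cite: Balaban1983RegularityDecay, Theorem p.573 (bookkeeping)] -/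
theorem thmPrintedNN_of_sumElim_right {I₁ I₂ : Type} (fam₁ : I₁ → EtaSetting) (fam₂ : I₂ → EtaSetting)
    (h : ThmPrintedNN (Sum.elim fam₁ fam₂)) : ThmPrintedNN fam₂ := by
  intro α hα0 hα1
  obtain ⟨δ₀, c₀, R₀, e₁, hδ, hc, hR, he, H⟩ := h α hα0 hα1
  exact ⟨δ₀, c₀, R₀, e₁, hδ, hc, hR, he, fun i => H (Sum.inr i)⟩

/-! ## §3. The sign facts of the three concrete families (the lineages' own lemmas) -/

section Signs

variable {ι : Type} [Fintype ι] [DecidableEq ι] (F : OrthFlow ι) (d ℓ : ℕ) (amin aplus m2plus creg β : ℝ) (K : ℕ)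

/-- the lattice region-pair family (L) has non-negative distance and sup-norm functionals. [cite: Balaban1983RegularityDecay, Theorem p.573, dictionary (`dist`, `‖f‖_∞ ≥ 0`)] -/
theorem regionPairFam_signs (i : RegionPairInst d ℓ amin aplus m2plus) :
    (∀ x f, 0 ≤ (regionPairFam F d ℓ amin aplus m2plus creg β K i).sdist1 x f) ∧
    (∀ x x' f, 0 ≤ (regionPairFam F d ℓ amin aplus m2plus creg β K i).sdist2 x x' f) ∧
    (∀ x, 0 ≤ (regionPairFam F d ℓ amin aplus m2plus creg β K i).bdist1 x) ∧
    (∀ x x', 0 ≤ (regionPairFam F d ℓ amin aplus m2plus creg β K i).bdist2 x x') ∧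
    (∀ f, 0 ≤ (regionPairFam F d ℓ amin aplus m2plus creg β K i).bdistS f) ∧
    (∀ f, 0 ≤ (regionPairFam F d ℓ amin aplus m2plus creg β K i).supNorm f) :=
  ⟨fun x f => i.sdist1_nonneg x f, fun x x' f => le_min (i.sdist1_nonneg x f) (i.sdist1_nonneg x' f),
    fun x => i.cdist_nonneg x, fun x x' => le_min (i.cdist_nonneg x) (i.cdist_nonneg x'),
    fun f => i.bdistS_nonneg f, fun f => supN_nonneg f⟩

/-- the lattice parallelepiped-pair family (B), collar-free side condition, has non-negative distance and sup-norm
functionals (its functionals are those of p17's `boxPairFam`). [cite: Balaban1983RegularityDecay, Theorem p.573, dictionary (`dist`, `‖f‖_∞ ≥ 0`)] -/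
theorem boxPairFamNC_signs (i : BoxPairInst d ℓ amin aplus m2plus) :
    (∀ x f, 0 ≤ (boxPairFamNC F d ℓ amin aplus m2plus creg β K i).sdist1 x f) ∧
    (∀ x x' f, 0 ≤ (boxPairFamNC F d ℓ amin aplus m2plus creg β K i).sdist2 x x' f) ∧
    (∀ x, 0 ≤ (boxPairFamNC F d ℓ amin aplus m2plus creg β K i).bdist1 x) ∧
    (∀ x x', 0 ≤ (boxPairFamNC F d ℓ amin aplus m2plus creg β K i).bdist2 x x') ∧
    (∀ f, 0 ≤ (boxPairFamNC F d ℓ amin aplus m2plus creg β K i).bdistS f) ∧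
    (∀ f, 0 ≤ (boxPairFamNC F d ℓ amin aplus m2plus creg β K i).supNorm f) :=
  ⟨fun x f => i.sdist1_nonneg x f, fun x x' f => le_min (i.sdist1_nonneg x f) (i.sdist1_nonneg x' f),
    fun x => i.bdist1_nonneg x, fun x x' => le_min (i.bdist1_nonneg x) (i.bdist1_nonneg x'),
    fun f => i.bdistS_nonneg f, fun f => supN_nonneg f⟩

/-- the torus region-pair family (T) has non-negative distance and sup-norm functionals (torus sup-metric).
[cite: Balaban1983RegularityDecay, Theorem p.573 and p.572 «operators on subsets of a torus T_η», dictionary] -/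
theorem torusPairFam_signs (i : TorusPairInst d ℓ amin aplus m2plus) :
    (∀ x f, 0 ≤ (torusPairFam F d ℓ amin aplus m2plus creg β K i).sdist1 x f) ∧
    (∀ x x' f, 0 ≤ (torusPairFam F d ℓ amin aplus m2plus creg β K i).sdist2 x x' f) ∧
    (∀ x, 0 ≤ (torusPairFam F d ℓ amin aplus m2plus creg β K i).bdist1 x) ∧
    (∀ x x', 0 ≤ (torusPairFam F d ℓ amin aplus m2plus creg β K i).bdist2 x x') ∧
    (∀ f, 0 ≤ (torusPairFam F d ℓ amin aplus m2plus creg β K i).bdistS f) ∧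
    (∀ f, 0 ≤ (torusPairFam F d ℓ amin aplus m2plus creg β K i).supNorm f) :=
  ⟨fun x f => tsdist1_nonneg i.P x f, fun x x' f => le_min (tsdist1_nonneg i.P x f) (tsdist1_nonneg i.P x' f),
    fun x => tcdist_nonneg i.P x, fun x x' => le_min (tcdist_nonneg i.P x) (tcdist_nonneg i.P x'),
    fun f => tbdistS_nonneg i.P f, fun f => supN_nonneg f⟩

end Signs

/-! ## §4. The joins: the lattice sentence (L) ⊕ (B), and both settings ((L) ⊕ (B)) ⊕ (T) -/

section Join

variable {ι : Type} [Fintype ι] [DecidableEq ι] (F : OrthFlow ι) {ℓ₁ : ℝ} (hℓ₁ : 0 ≤ ℓ₁)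
  (hLip : ∀ t (v : ι → ℝ), ((F.U t - 1) *ᵥ v) ⬝ᵥ ((F.U t - 1) *ᵥ v) ≤ (ℓ₁ * t) ^ 2 * (v ⬝ᵥ v))
  (d ℓ : ℕ) (hd : 1 ≤ d) (hℓ : 1 ≤ ℓ) (amin aplus m2plus : ℝ) (ha : 0 < amin)
  (creg β : ℝ) (hcreg : 0 ≤ creg) (hβ : 0 < β)

include hcreg hβ in
/-- **THEOREM p. 573 ON THE LATTICE `ηℤ^{d+1}` WITH THE PARALLELEPIPED WAIVER, ONE SET OF CONSTANTS**: `ThmPrintedNN` on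
the join of (L) the general big-block pairs `Ω ⊂ Ω₀ ⊂ ηℤ^{d+1}` (`R₀` restriction, block size `Kmod`) and (B) the nested
parallelepiped pairs (`rect := True`: (1.9)–(1.12) for ALL `x, x′ ∈ Ω`, modulus `KmodNC`), at every (1.7)-regular field
with the family's `(c, β)`, for a Lipschitz orthogonal flow, `d ≥ 1`, `L = ℓ+1 ≥ 2`, `a₋ > 0`.
[cite: Balaban1983RegularityDecay, Theorem (1.9)–(1.12) p.573 incl. «for rectangular parallelepipeds, the inequalities hold without any restrictions on the points x, x′»] -/
theorem thmPrintedNN_latticeJoin :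
    ThmPrintedNN (Sum.elim
      (regionPairFam F d ℓ amin aplus m2plus creg β (Kmod F hℓ₁ hLip d ℓ hℓ amin aplus m2plus ha))
      (boxPairFamNC F d ℓ amin aplus m2plus creg β (KmodNC F hℓ₁ hLip d ℓ hd hℓ amin aplus m2plus ha))) :=
  thmPrintedNN_sumElim _ _ (fun i => regionPairFam_signs F d ℓ amin aplus m2plus creg β _ i)
    (fun i => boxPairFamNC_signs F d ℓ amin aplus m2plus creg β _ i)
    (thmPrintedNN_regionPairFam F hℓ₁ hLip d ℓ hℓ amin aplus m2plus ha creg β hcreg hβ)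
    (thmPrintedNN_boxPairFamNC F hℓ₁ hLip d ℓ hd hℓ amin aplus m2plus ha creg β hcreg hβ)

include hcreg hβ in
/-- **THEOREM p. 573 ON BOTH PRINTED SETTINGS AT ONCE, ONE SET OF CONSTANTS** («a lattice ηZ^d or its subsets … Another
common case … a torus T_η», p. 572): `ThmPrintedNN` on the triple join ((L) lattice big-block pairs ⊕ (B) lattice
parallelepiped pairs) ⊕ (T) torus pairs `Ω ⊂ Ω₀ ⊂ T_η` — for every `α ∈ [0,1)` ONE `(δ₀, c₀, R₀, e₁)` such that every
(1.7)-regular instance of any of the three kinds with big blocks and `0 < e ≤ e₁` satisfies (1.9)–(1.12), the `R₀`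
restriction being waived exactly where the summand's `rect` holds (every instance of (B); the instances `Ω = T_η` of (T)).
[cite: Balaban1983RegularityDecay, Theorem (1.9)–(1.12) p.573; p.572 (the two settings)] -/
theorem thmPrintedNN_join3 :
    ThmPrintedNN (Sum.elim (Sum.elim
      (regionPairFam F d ℓ amin aplus m2plus creg β (Kmod F hℓ₁ hLip d ℓ hℓ amin aplus m2plus ha))
      (boxPairFamNC F d ℓ amin aplus m2plus creg β (KmodNC F hℓ₁ hLip d ℓ hd hℓ amin aplus m2plus ha)))
      (torusPairFam F d ℓ amin aplus m2plus creg β (Kmod F hℓ₁ hLip d ℓ hℓ amin aplus m2plus ha))) := by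
  refine thmPrintedNN_sumElim _ _ ?_ (fun i => torusPairFam_signs F d ℓ amin aplus m2plus creg β _ i)
    (thmPrintedNN_latticeJoin F hℓ₁ hLip d ℓ hd hℓ amin aplus m2plus ha creg β hcreg hβ)
    (thmPrintedNN_torusPairFam F hℓ₁ hLip d ℓ hℓ amin aplus m2plus ha creg β hcreg hβ)
  rintro (i | i)
  · exact regionPairFam_signs F d ℓ amin aplus m2plus creg β _ i
  · exact boxPairFamNC_signs F d ℓ amin aplus m2plus creg β _ i

/-! ## §5. The four-conjunct leaf with the joined `η`-family; non-vacuity of every summand -/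

variable (hap : amin ≤ aplus) {a' : ℝ} (ha' : 0 < a') {a m2 C a₀ p : ℝ} (ha0 : 0 < a) (hm : 0 ≤ m2) (hC : 0 ≤ C)
  (ha₀ : 0 ≤ a₀) (hp : 0 < p) (d₅ N₅ : ℕ)

include hap hcreg hβ ha' ha0 hm hC ha₀ hp in
/-- **THE DAG LEAF `b4` IN ITS `0 ≤ α` FORM, ALL FOUR CONJUNCTS, WITH THE JOINED `η`-FAMILY**: Theorem p. 573
(`ThmPrintedNN`) on ((L) ⊕ (B)) ⊕ (T) ∧ «Proposition 2.3 of [1]» (1.15)–(1.20) on the window family of nested unions of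
`L`-blocks ∧ «Proposition 3.1′ of [2]» (1.21)–(1.22) on every finite union of unit blocks ∧ the Sect. 5 Theorem at
`(d₅, N₅)` — the legs 2–4 exactly those of `B4LeafRegular.leafNN_torusPairFam`; this 4-tuple is the body of
`DagDischargedII.B4LeafNN` for these families. [cite: Balaban1983RegularityDecay, Theorem (1.9)–(1.12) p.573; Prop. 2.3 of [1] (1.15)–(1.20) p.574; Prop. 3.1′ of [2] (1.21)–(1.22) p.574; Sect. 5 Theorem p.594] -/
theorem leafNN_join3 :
    ThmPrintedNN (Sum.elim (Sum.elim
      (regionPairFam F d ℓ amin aplus m2plus creg β (Kmod F hℓ₁ hLip d ℓ hℓ amin aplus m2plus ha))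
      (boxPairFamNC F d ℓ amin aplus m2plus creg β (KmodNC F hℓ₁ hLip d ℓ hd hℓ amin aplus m2plus ha)))
      (torusPairFam F d ℓ amin aplus m2plus creg β (Kmod F hℓ₁ hLip d ℓ hℓ amin aplus m2plus ha))) ∧
    Prop23Printed (regularFieldRegionsW (d := d) F (Nat.succ_le_succ (Nat.zero_le ℓ) : 1 ≤ ℓ + 1)
      amin aplus a' creg β m2plus) ∧
    Prop31Printed (regularFormSetting (d := d) F a m2 C a₀ p) ∧
    Sect5ThmUniform d₅ N₅ :=
  ⟨thmPrintedNN_join3 F hℓ₁ hLip d ℓ hd hℓ amin aplus m2plus ha creg β hcreg hβ,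
   prop23Printed_regularWindow F hℓ₁ hLip _ ha hap ha' hcreg hβ m2plus,
   prop31Printed_regularRegion F hℓ₁ hLip ha0 hm hC ha₀ hp,
   sect5ThmUniform_holds d₅ N₅⟩

include hap hcreg in
/-- **NON-VACUITY OF EVERY SUMMAND**: for every threshold `e₁ > 0` each of the three joined families has an instance
meeting its antecedents `regular ∧ bigBlocks ∧ 0 < e ≤ e₁` at the block sizes of the join (`Kmod ≥ 16`, `KmodNC ≥ 16`)
— so none of the three restrictions of `thmPrintedNN_join3` is about an empty class of instances (vacuity standard
Q-N00-6; witnesses are the lineages': zero field on one cube ∕ a box pair ∕ a one-cube torus region).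
[cite: Balaban1983RegularityDecay, Theorem p.573 «for e sufficiently small» (non-vacuity bookkeeping)] -/
theorem join3_nonvacuous (hm2 : 0 ≤ m2plus) (e₁ : ℝ) (he₁ : 0 < e₁) :
    (∃ i : RegionPairInst d ℓ amin aplus m2plus,
      (regionPairFam F d ℓ amin aplus m2plus creg β (Kmod F hℓ₁ hLip d ℓ hℓ amin aplus m2plus ha) i).regular ∧
      (regionPairFam F d ℓ amin aplus m2plus creg β (Kmod F hℓ₁ hLip d ℓ hℓ amin aplus m2plus ha) i).bigBlocks ∧
      0 < (regionPairFam F d ℓ amin aplus m2plus creg β (Kmod F hℓ₁ hLip d ℓ hℓ amin aplus m2plus ha) i).e ∧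
      (regionPairFam F d ℓ amin aplus m2plus creg β (Kmod F hℓ₁ hLip d ℓ hℓ amin aplus m2plus ha) i).e ≤ e₁) ∧
    (∃ i : BoxPairInst d ℓ amin aplus m2plus,
      (boxPairFamNC F d ℓ amin aplus m2plus creg β (KmodNC F hℓ₁ hLip d ℓ hd hℓ amin aplus m2plus ha) i).regular ∧
      (boxPairFamNC F d ℓ amin aplus m2plus creg β (KmodNC F hℓ₁ hLip d ℓ hd hℓ amin aplus m2plus ha) i).bigBlocks ∧
      0 < (boxPairFamNC F d ℓ amin aplus m2plus creg β (KmodNC F hℓ₁ hLip d ℓ hd hℓ amin aplus m2plus ha) i).e ∧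
      (boxPairFamNC F d ℓ amin aplus m2plus creg β (KmodNC F hℓ₁ hLip d ℓ hd hℓ amin aplus m2plus ha) i).e ≤ e₁) ∧
    (∃ i : TorusPairInst d ℓ amin aplus m2plus,
      (torusPairFam F d ℓ amin aplus m2plus creg β (Kmod F hℓ₁ hLip d ℓ hℓ amin aplus m2plus ha) i).regular ∧
      (torusPairFam F d ℓ amin aplus m2plus creg β (Kmod F hℓ₁ hLip d ℓ hℓ amin aplus m2plus ha) i).bigBlocks ∧
      0 < (torusPairFam F d ℓ amin aplus m2plus creg β (Kmod F hℓ₁ hLip d ℓ hℓ amin aplus m2plus ha) i).e ∧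
      (torusPairFam F d ℓ amin aplus m2plus creg β (Kmod F hℓ₁ hLip d ℓ hℓ amin aplus m2plus ha) i).e ≤ e₁) := by
  have hK : 1 ≤ Kmod F hℓ₁ hLip d ℓ hℓ amin aplus m2plus ha :=
    le_trans (by norm_num)
      (Classical.choose_spec (B4ThmRegionPairEta.region_pair_members F hℓ₁ hLip d ℓ hℓ amin aplus m2plus ha)).1
  have hK' : 1 ≤ KmodNC F hℓ₁ hLip d ℓ hd hℓ amin aplus m2plus ha :=
    le_trans (by norm_num)
      (Classical.choose_spec
        (B4ThmBoxPairEtaNoCollar.box_pair_members_noCollar F hℓ₁ hLip d ℓ hd hℓ amin aplus m2plus ha)).1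
  exact ⟨B4ThmRegionPairEta.hypotheses_met F d ℓ hap hm2 creg β hcreg _ hK e₁ he₁,
    hypotheses_met_noCollar F d ℓ hap hm2 creg β hcreg _ hK' e₁ he₁,
    B4ThmTorusPairEta.hypotheses_met F d ℓ hap hm2 creg β hcreg _ hK e₁ he₁⟩

end Join

end Literature.MathematicalPhysics.QuantumFieldTheory.Balaban1983to89.B4ThmJoinFam
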